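import Summits.ValiantsHypothesis.ValiantsHypothesis.Theorems.NewtonUnitEquationsTwoProductsPlanarCellBlockLaw
import HarnessLib

/-!
# Route NewtonUnitEquations — crux `TwoProducts` (stmt-ValiantsHypothesis-5906): quotable corollaries of the block law
# (crit-3 VERDICT #11 price P2 for the line `Cruxes/TwoProducts/Lines/relation_ladder.lean`, val-idea-8 g2; verbatim the line file @4094017b3f5d)

Helper mode (`--supports stmt-ValiantsHypothesis-5906 --as helper`; turnkey packaged by the ideator seat val-idea-8 g2).
Two specialisations of the landed `planarCell_blockLaw` (p608838) with the block `J = univ` (where `Confined A univ` is void):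
* `planarCell_smallSumset`: if every letter tuple of the instance sums into a set of `≤ M` points, then per cell
  `#S ≤ 2^{3m}(M + 2t + 2)^9` — for EVERY configuration of coincidences;
* `planarCell_of_le_four`: for `m ≤ 4` factor pairs the per-cell bound `#S ≤ 2^{3m}((2t+1)^4 + 2t + 2)^9` holds
  UNCONDITIONALLY (the full sumset has `≤ (2t+1)^m` points), so the line's residual lives at `m ≥ 5`.
Honest framing: corollaries of a rung; `PlanarCellBound`, the crux `TwoProducts` and `VP ≠ VNP` are OPEN and NOT claimed.
No instances, no notation, no named literature facts. [folklore]
-/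

noncomputable section

-- Sub = Summit single-conjunct layout: the duplicated namespace component is mandated by the tree.
set_option linter.dupNamespace false

open scoped BigOperators
open MvPolynomial
open Summit.ValiantsHypothesis.ValiantsHypothesis.Theorems.NewtonUnitEquations.TwoProducts.FormalLogLinearisation

namespace Summit.ValiantsHypothesis.ValiantsHypothesis.Theorems.NewtonUnitEquations.TwoProducts.PlanarCell

variable {m : ℕ}

/-- `Confined A univ` always holds (nothing is asked off `univ`). [folklore] -/
theorem confined_univ (A : Fin m → Finset Expo) : Confined A Finset.univ :=
  fun _ _ _ _ _ j hj => absurd (Finset.mem_univ j) hj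

/-- `BlockSmall` is monotone in the size bound. [folklore] -/
theorem blockSmall_mono {A : Fin m → Finset Expo} {J : Finset (Fin m)} {M M' : ℕ} (h : BlockSmall A J M) (hM : M ≤ M') :
    BlockSmall A J M' := by
  obtain ⟨P, hP, hmem⟩ := h
  exact ⟨P, hP.trans hM, hmem⟩

/-- **Small full sumset ⇒ the planar-cell bound** (block law with `J = univ`): if every letter tuple of the instance sums into a
set of `≤ M` points then per cell `#S ≤ 2^{3m}(M + 2t + 2)^9` — for every configuration, no confinement asked. [folklore] -/
theorem planarCell_smallSumset (t M : ℕ) (u v : Fin m → MvPolynomial (Fin 2) ℂ)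
    (hu : ∀ j, coeff 0 (u j) = 0 ∧ (u j).support.card ≤ t) (hv : ∀ j, coeff 0 (v j) = 0 ∧ (v j).support.card ≤ t)
    (hM : BlockSmall (fun j => (u j).support ∪ (v j).support) Finset.univ M)
    (R : Expo → Expo → Prop) (S : Finset Expo) (hS : IsCellFamily u v R S) :
    S.card ≤ 2 ^ (3 * m) * (M + 2 * t + 2) ^ 9 := by
  have hA0 : ∀ j, (0 : Expo) ∉ (u j).support ∪ (v j).support := by
    intro j h
    rcases Finset.mem_union.1 h with h | h
    · exact (mem_support_iff.1 h) (hu j).1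
    · exact (mem_support_iff.1 h) (hv j).1
  have hAs : ∀ j, ((u j).support ∪ (v j).support).card ≤ 2 * t := by
    intro j
    calc ((u j).support ∪ (v j).support).card ≤ (u j).support.card + (v j).support.card := Finset.card_union_le _ _
      _ ≤ t + t := Nat.add_le_add (hu j).2 (hv j).2
      _ = 2 * t := by ring
  exact planarCell_blockLaw (2 * t) M u v (fun j => (u j).support ∪ (v j).support) Finset.univ hA0 hAs
    (fun j => Finset.subset_union_left) (fun j => Finset.subset_union_right) (confined_univ _) hM R S hS

/-- **`m ≤ 4` ⇒ the planar-cell bound UNCONDITIONALLY**: the full sumset has `≤ (2t+1)^m ≤ (2t+1)^4` points, so per cell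
`#S ≤ 2^{3m}((2t+1)^4 + 2t + 2)^9`. [folklore] -/
theorem planarCell_of_le_four (t : ℕ) (hm : m ≤ 4) (u v : Fin m → MvPolynomial (Fin 2) ℂ)
    (hu : ∀ j, coeff 0 (u j) = 0 ∧ (u j).support.card ≤ t) (hv : ∀ j, coeff 0 (v j) = 0 ∧ (v j).support.card ≤ t)
    (R : Expo → Expo → Prop) (S : Finset Expo) (hS : IsCellFamily u v R S) :
    S.card ≤ 2 ^ (3 * m) * ((2 * t + 1) ^ 4 + 2 * t + 2) ^ 9 := by
  have hAs : ∀ j, ((u j).support ∪ (v j).support).card ≤ 2 * t := by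
    intro j
    calc ((u j).support ∪ (v j).support).card ≤ (u j).support.card + (v j).support.card := Finset.card_union_le _ _
      _ ≤ t + t := Nat.add_le_add (hu j).2 (hv j).2
      _ = 2 * t := by ring
  have hsmall := blockSmall_of_card (fun j => (u j).support ∪ (v j).support) Finset.univ (2 * t) hAs
  have hle : (2 * t + 1) ^ (Finset.univ : Finset (Fin m)).card ≤ (2 * t + 1) ^ 4 := by
    rw [Finset.card_univ, Fintype.card_fin]; exact Nat.pow_le_pow_right (by omega) hm
  exact planarCell_smallSumset t ((2 * t + 1) ^ 4) u v hu hv (blockSmall_mono hsmall hle) R S hS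

end Summit.ValiantsHypothesis.ValiantsHypothesis.Theorems.NewtonUnitEquations.TwoProducts.PlanarCell

end
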